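import Summits.CriticalPhenomena.PercolationContinuityZ3.Theorems.SahiMasterFamilySDHFlat

/-!
# SDH♭(3) holds: the first rung of the slot-decoupled ladder, and the two smallest block coefficients in closed form

Unit `prim-masterthm-p4` (gen 18; crux anchor stmt-CriticalPhenomena-4575, helper work; memo
`run/shared/lean/prim/prim-masterthm/prim-masterthm-p4/DELETION-PICTURE.md` §2–§3).  Companion of `…SDHFlat` (typed conjecture
`SDHFlatNonneg k` = SDH♭(k): `Λ(𝒢, β) ≥ 0` for one union-closed family `𝒢 ∋ univ` against one hull point `β`; kernel `SDH♭ ⟹ H♭ ⟹ (UC-hull)`).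

* `blockCoef_eq_neg_phiSet_of_equiv` — the block coefficient `κ_B(β) = −Φ_{|Bᶜ|}(S ↦ β(e S))` for ANY enumeration `e : Fin m ≃ Bᶜ`
  (the `∃`-free form of `blockCoef_eq_neg_phiSet_map`, so that small complements can be computed);
* `blockCoef_of_compl_eq_singleton` — `Bᶜ = {z}` ⟹ `κ_B(β) = −β_{z}`;  `blockCoef_of_compl_eq_pair` — `Bᶜ = {a,b}` ⟹ `κ_B(β) = β_{a}β_{b} − β_{ab}`;
* `lam_three_eq` — on three points, for every family `𝒢 ∋ univ` and every set function `β`,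
  `Λ(𝒢, β) = 6 − 2·Σ_z [univ∖z ∈ 𝒢]·β_{z} − Σ_t [{t} ∈ 𝒢]·(2 − β_{a} − β_{b})` (`{a,b} = univ∖t`) — the memo's `Λ = Σ_{S∉𝒢} c_d(S)` at k = 3;
* `lam_three_nonneg_of_box` — hence `Λ(𝒢, β) ≥ 0` for every `𝒢 ∋ univ` (union-closure not needed) and every `0 ≤ β ≤ 1`;
* **`sdhFlatNonneg_three : SDHFlatNonneg 3`** (down the already-landed ladder `hFlatNonneg_of_sdhFlatNonneg` / `ucHullNonneg_of_sdhFlatNonneg`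
  this re-proves `HFlatNonneg 3` and `UCHullNonneg 3`, which are in the tree; not restated here).

HONEST FRAMING: k = 3 is the trivial rung (every summand of the localisation is termwise nonnegative on the box); SDH♭(k) for k ≥ 4 (where the
hull structure of `β` is genuinely used), H♭ (k ≥ 5), H♯ (k ≥ 4), (UC-hull)_k (k ≥ 8), Sahi's `C_k` and the master theorem remain OPEN.
Axioms standard. [this work]
-/

noncomputable section

open scoped Classical

namespace Summit.CriticalPhenomena.PercolationContinuityZ3.Theorems

namespace SDHFlat

open Finset Function
open Literature.Combinatorics.Sahi2008
open Literature.Combinatorics.Sahi2008.CycleForm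
open PrincipalCapBeta (phiSet realW realF ex_realW_prod phiSet_eq_sahiE_real phiSet_one phiSet_two)
open HFlat (mixture_nonneg)
open HSharp (mixture_le_one)

variable {k : ℕ}

/-! ### Block coefficients of small co-dimension -/

/-- **`κ_B(β) = −Φ_m(S ↦ β(e(S)))` for every enumeration `e : Fin m ≃ Bᶜ`** (`m ≥ 1`; [LiebSahi2021, Prop. 3.4] in the canonical model,
re-indexed along `e`). [this work] -/
theorem blockCoef_eq_neg_phiSet_of_equiv (β : Finset (Fin (k + 1)) → ℝ) {B : Finset (Fin (k + 1))} (hBu : B ≠ univ)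
    {n : ℕ} (e0 : Fin (n + 1) ≃ {x // x ∉ B}) :
    blockCoef β B = -phiSet (n + 1) (fun S => β (S.map (e0.toEmbedding.trans (Embedding.subtype _)))) := by
  unfold blockCoef
  rw [coRest_of_ne_univ _ _ hBu, ← cycleSum_comp_equiv (realW β) e0 (fun j : {x // x ∉ B} => realF (j : Fin (k + 1))),
    ← sahiE_eq_cycleSum (realW β) (Nat.succ_le_succ (Nat.zero_le n)), PrincipalCapBeta.sahiE_eq_phiSet]
  congr 2
  funext S
  have e1 : (∏ x ∈ S, realF ((e0 x : {x // x ∉ B}) : Fin (k + 1))) =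
      ∏ x ∈ S.map (e0.toEmbedding.trans (Embedding.subtype _)), (realF x : Finset (Fin (k + 1)) → ℝ) := by
    rw [prod_map]; rfl
  rw [e1, ex_realW_prod]

/-- **`Bᶜ = {z}` ⟹ `κ_B(β) = −β_{z}`.** [this work] -/
theorem blockCoef_of_compl_eq_singleton (β : Finset (Fin (k + 1)) → ℝ) {B : Finset (Fin (k + 1))} {z : Fin (k + 1)}
    (hB : Bᶜ = {z}) : blockCoef β B = -β {z} := by
  have hmem : ∀ x, x ∉ B ↔ x = z := fun x => by rw [← mem_compl, hB, mem_singleton]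
  have hz : z ∉ B := (hmem z).2 rfl
  have hBu : B ≠ univ := fun h => hz (h ▸ mem_univ z)
  let e0 : Fin (0 + 1) ≃ {x // x ∉ B} :=
    { toFun := fun _ => ⟨z, hz⟩
      invFun := fun _ => 0
      left_inv := fun i => (Fin.fin_one_eq_zero i).symm
      right_inv := fun x => Subtype.ext ((hmem x.1).1 x.2).symm }
  have hmap : (univ : Finset (Fin (0 + 1))).map (e0.toEmbedding.trans (Embedding.subtype _)) = {z} := by
    ext y
    simp only [mem_map, mem_univ, true_and, mem_singleton, Embedding.trans_apply, Equiv.coe_toEmbedding, Embedding.coe_subtype]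
    constructor
    · rintro ⟨a, rfl⟩; rfl
    · rintro rfl; exact ⟨0, rfl⟩
  rw [blockCoef_eq_neg_phiSet_of_equiv β hBu e0, phiSet_one, hmap]

/-- **`Bᶜ = {a, b}` (`a ≠ b`) ⟹ `κ_B(β) = β_{a}·β_{b} − β_{ab}`.** [this work] -/
theorem blockCoef_of_compl_eq_pair (β : Finset (Fin (k + 1)) → ℝ) {B : Finset (Fin (k + 1))} {a b : Fin (k + 1)}
    (hab : a ≠ b) (hB : Bᶜ = {a, b}) : blockCoef β B = β {a} * β {b} - β {a, b} := by
  have hmem : ∀ x, x ∉ B ↔ (x = a ∨ x = b) := fun x => by rw [← mem_compl, hB, mem_insert, mem_singleton]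
  have ha : a ∉ B := (hmem a).2 (Or.inl rfl)
  have hb : b ∉ B := (hmem b).2 (Or.inr rfl)
  have hBu : B ≠ univ := fun h => ha (h ▸ mem_univ a)
  let f : Fin (1 + 1) → {x // x ∉ B} := fun i => if i = 0 then ⟨a, ha⟩ else ⟨b, hb⟩
  have hf0 : f 0 = ⟨a, ha⟩ := by simp only [f, if_pos rfl]
  have hf1 : f 1 = ⟨b, hb⟩ := by simp only [f, if_neg (show (1 : Fin (1 + 1)) ≠ 0 by decide)]
  have hf : Function.Bijective f := by
    constructor
    · intro i j h
      rcases Fin.eq_zero_or_eq_succ i with hi | ⟨i', hi⟩ <;> rcases Fin.eq_zero_or_eq_succ j with hj | ⟨j', hj⟩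
      · rw [hi, hj]
      · exfalso
        have hj1 : j = 1 := by rw [hj, Fin.fin_one_eq_zero j']; rfl
        rw [hi, hj1, hf0, hf1] at h
        exact hab (congrArg Subtype.val h)
      · exfalso
        have hi1 : i = 1 := by rw [hi, Fin.fin_one_eq_zero i']; rfl
        rw [hj, hi1, hf0, hf1] at h
        exact hab (congrArg Subtype.val h).symm
      · rw [hi, hj, Fin.fin_one_eq_zero i', Fin.fin_one_eq_zero j']
    · intro x
      rcases (hmem x.1).1 x.2 with h | h
      · exact ⟨0, by rw [hf0]; exact Subtype.ext h.symm⟩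
      · exact ⟨1, by rw [hf1]; exact Subtype.ext h.symm⟩
  let e0 : Fin (1 + 1) ≃ {x // x ∉ B} := Equiv.ofBijective f hf
  have he0 : ∀ i, e0 i = f i := fun i => rfl
  rw [blockCoef_eq_neg_phiSet_of_equiv β hBu e0, phiSet_two]
  have m0 : ({0} : Finset (Fin (1 + 1))).map (e0.toEmbedding.trans (Embedding.subtype _)) = {a} := by
    ext y
    simp only [mem_map, mem_singleton, Embedding.trans_apply, Equiv.coe_toEmbedding, Embedding.coe_subtype]
    constructor
    · rintro ⟨i, rfl, rfl⟩; rw [he0, hf0]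
    · rintro rfl; exact ⟨0, rfl, by rw [he0, hf0]⟩
  have m1 : ({1} : Finset (Fin (1 + 1))).map (e0.toEmbedding.trans (Embedding.subtype _)) = {b} := by
    ext y
    simp only [mem_map, mem_singleton, Embedding.trans_apply, Equiv.coe_toEmbedding, Embedding.coe_subtype]
    constructor
    · rintro ⟨i, rfl, rfl⟩; rw [he0, hf1]
    · rintro rfl; exact ⟨1, rfl, by rw [he0, hf1]⟩
  have mu : (univ : Finset (Fin (1 + 1))).map (e0.toEmbedding.trans (Embedding.subtype _)) = {a, b} := by
    ext y
    simp only [mem_map, mem_univ, true_and, mem_insert, mem_singleton, Embedding.trans_apply, Equiv.coe_toEmbedding,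
      Embedding.coe_subtype]
    constructor
    · rintro ⟨i, rfl⟩
      rcases Fin.eq_zero_or_eq_succ i with hi | ⟨i', hi⟩
      · left; rw [hi, he0, hf0]
      · right
        have hi1 : i = 1 := by rw [hi, Fin.fin_one_eq_zero i']; rfl
        rw [hi1, he0, hf1]
    · rintro (rfl | rfl)
      · exact ⟨0, by rw [he0, hf0]⟩
      · exact ⟨1, by rw [he0, hf1]⟩
  rw [m0, m1, mu]
  ring

/-! ### Three points -/

/-- Summing over the eight subsets of `Fin 3`. [folklore] -/
theorem sum_finset_fin_three (F : Finset (Fin 3) → ℝ) :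
    ∑ B : Finset (Fin 3), F B = F ∅ + F {2} + (F {1} + F {1, 2}) + (F {0} + F {0, 2} + (F {0, 1} + F univ)) := by
  have hU : (univ : Finset (Fin 3)) = insert 0 (insert 1 (insert 2 ∅)) := by decide
  rw [← powerset_univ, hU]
  simp only [sum_powerset_insert (show (0 : Fin 3) ∉ (insert 1 (insert 2 ∅) : Finset (Fin 3)) by decide),
    sum_powerset_insert (show (1 : Fin 3) ∉ (insert 2 ∅ : Finset (Fin 3)) by decide),
    sum_powerset_insert (show (2 : Fin 3) ∉ (∅ : Finset (Fin 3)) by decide), powerset_empty, sum_singleton]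
  simp only [insert_empty]

/-- **`Λ(𝒢, β)` on three points in closed form**: for every family `𝒢 ∋ univ` and every set function `β`,
`Λ(𝒢, β) = 6 − 2·([12∈𝒢]β_0 + [02∈𝒢]β_1 + [01∈𝒢]β_2) − ([0∈𝒢](2−β_1−β_2) + [1∈𝒢](2−β_0−β_2) + [2∈𝒢](2−β_0−β_1))` — the memo's
`Λ = Σ_{S∉𝒢} c_d(S)` at k = 3, every `c_d(S)` visible and nonnegative on the box. [this work] -/
theorem lam_three_eq (𝒢 : Finset (Finset (Fin 3))) (htop : univ ∈ 𝒢) (β : Finset (Fin 3) → ℝ) :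
    lam 𝒢 β = 6
      - 2 * ((if ({1, 2} : Finset (Fin 3)) ∈ 𝒢 then β {0} else 0) + (if ({0, 2} : Finset (Fin 3)) ∈ 𝒢 then β {1} else 0)
              + (if ({0, 1} : Finset (Fin 3)) ∈ 𝒢 then β {2} else 0))
      - ((if ({0} : Finset (Fin 3)) ∈ 𝒢 then 2 - β {1} - β {2} else 0) + (if ({1} : Finset (Fin 3)) ∈ 𝒢 then 2 - β {0} - β {2} else 0)
          + (if ({2} : Finset (Fin 3)) ∈ 𝒢 then 2 - β {0} - β {1} else 0)) := by
  -- the seven block coefficients that matter (`κ_∅` only ever appears with weight zero)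
  have κu : blockCoef β (univ : Finset (Fin 3)) = 1 := blockCoef_univ β
  have κ01 : blockCoef β ({0, 1} : Finset (Fin 3)) = -β {2} :=
    blockCoef_of_compl_eq_singleton (k := 2) β (by decide)
  have κ02 : blockCoef β ({0, 2} : Finset (Fin 3)) = -β {1} :=
    blockCoef_of_compl_eq_singleton (k := 2) β (by decide)
  have κ12 : blockCoef β ({1, 2} : Finset (Fin 3)) = -β {0} :=
    blockCoef_of_compl_eq_singleton (k := 2) β (by decide)
  have κ0 : blockCoef β ({0} : Finset (Fin 3)) = β {1} * β {2} - β {1, 2} :=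
    blockCoef_of_compl_eq_pair (k := 2) β (by decide) (by decide)
  have κ1 : blockCoef β ({1} : Finset (Fin 3)) = β {0} * β {2} - β {0, 2} :=
    blockCoef_of_compl_eq_pair (k := 2) β (by decide) (by decide)
  have κ2 : blockCoef β ({2} : Finset (Fin 3)) = β {0} * β {1} - β {0, 1} :=
    blockCoef_of_compl_eq_pair (k := 2) β (by decide) (by decide)
  have c01 : ({0, 1} : Finset (Fin 3)).card = 2 := by decide
  have c02 : ({0, 2} : Finset (Fin 3)).card = 2 := by decide
  have c12 : ({1, 2} : Finset (Fin 3)).card = 2 := by decide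
  have cu : (univ : Finset (Fin 3)).card = 3 := by rw [card_univ, Fintype.card_fin]
  -- the hybrid functional as an indicator sum over all eight subsets
  have hhyb : hyb 𝒢 β = ∑ B : Finset (Fin 3), (if B ∈ 𝒢 then ((B.card : ℝ) * ((B.card - 1).factorial : ℝ)) * blockCoef β B else 0) := by
    unfold hyb
    rw [← sum_filter]
    congr 1
    ext B; simp only [mem_filter, mem_univ, true_and]
  -- the capped functionals
  have hcap : ∀ t : Fin 3, phiSet 3 (fun S => if t ∈ S then 1 else β S) =
      ∑ B : Finset (Fin 3), (if t ∈ B then ((B.card - 1).factorial : ℝ) * blockCoef β B else 0) :=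
    fun t => phiSet_cap_eq_sum_blockCoef (k := 2) β t
  unfold lam
  rw [hhyb, Fin.sum_univ_three, hcap 0, hcap 1, hcap 2, sum_finset_fin_three, sum_finset_fin_three, sum_finset_fin_three,
    sum_finset_fin_three]
  simp only [Fin.isValue, mem_insert, mem_singleton, mem_univ, notMem_empty, if_true, if_false, if_pos htop, card_empty,
    card_singleton, c01, c02, c12, cu, κu, κ01, κ02, κ12, κ0, κ1, κ2, Nat.cast_zero, zero_mul, ite_self]
  norm_num [Fin.ext_iff, Nat.factorial]
  split_ifs <;> ring

/-- **SDH♭ on three points, on the bare box**: `Λ(𝒢, β) ≥ 0` for every family `𝒢 ∋ univ` (union-closure NOT needed) and every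
`0 ≤ β ≤ 1`. [this work] -/
theorem lam_three_nonneg_of_box (𝒢 : Finset (Finset (Fin 3))) (htop : univ ∈ 𝒢) (β : Finset (Fin 3) → ℝ)
    (h0 : ∀ B, 0 ≤ β B) (h1 : ∀ B, β B ≤ 1) : 0 ≤ lam 𝒢 β := by
  rw [lam_three_eq 𝒢 htop β]
  have a0 := h0 {0}; have a1 := h0 {1}; have a2 := h0 {2}
  have b0 := h1 {0}; have b1 := h1 {1}; have b2 := h1 {2}
  split_ifs <;> linarith

/-- **SDH♭(3)** (`SDHFlatNonneg 3`): every mixture of union-closed indicator functions lies in the box. [this work] -/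
theorem sdhFlatNonneg_three : SDHFlatNonneg 3 := by
  intro α _ w 𝒰 hw0 hw1 _ _ 𝒢 _ htop
  exact lam_three_nonneg_of_box 𝒢 htop _ (fun B => mixture_nonneg w 𝒰 hw0 B) (fun B => mixture_le_one w 𝒰 hw0 hw1 B)

end SDHFlat

end Summit.CriticalPhenomena.PercolationContinuityZ3.Theorems
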